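import Literature.AnabelianGeometry.SemiGraphs.MetabelianLeafStarEscapeElement
import Literature.AnabelianGeometry.SemiGraphs.TemperedPiBranchTransit
import Literature.AnabelianGeometry.SemiGraphs.TreeFixedLocusBounce
import HarnessLib

/-!
# The tree walk of the rayless escape: translation characters are constant along type-`n`-free walks
# («RAYLESS-STAR·CIV-NEG», brick S5d, part 3b)

Mochizuki, *Semi-graphs of anabelioids*, Publ. RIMS **42** (2006), Lemma 1.8 (ii) p. 20, Remark 2.2.1 p. 24,
Theorem 3.7 (i), (iii) pp. 40–41 [cite: MochizukiSemiAnbd2006, Thm 3.7(iii) p.41].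

PROOF-ONLY file (abc-iut cell, layer L3, row «RAYLESS-STAR·CIV-NEG», seat abc-iut-L3-t8 gen 6; desk memo
VERTICAL-ESCAPE-RAYLESS-STAR-L3t8g6.md §§4–5, the "walk lemma").  In a level tree `𝔾̃_N` of the canonical
tower of `𝒢⋆(p) = metabelianLeafStar p`, with the centre sequence `P₀` and the leaf sequences
`leafSeq P₀ m` of `MetabelianLeafStarEscapeElement.lean`:

* `leafSeq_smul`, `toEdgeSeq_leafSeq` — the leaf sequences of a translate / un-gluing a leaf sequence;
* `exists_leafSeq_smul_vertex_eq` / `exists_smul_vertex_eq_of_leafSeq` — ONE STEP of a walk: the far end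
  of a tree edge at the centre-type vertex `(g·P₀).vertex N` over the base branch `(m, true)` is
  `((g ψ₀(f)) · P_m).vertex N`, and the far end of a tree edge at `(a·P_m).vertex N` is `((a ψ_m(l))·P₀).vertex N`
  (branch transit, `TemperedPiBranchTransit.lean`);
* `chi_eq_of_smul_vertex_eq`, **`chi_eq_of_walk`** — for a character `χ` of `π₁^temp` killing `ker ρ_N`,
  `ψ₀(Π_centre)` and `ψ_m(Leaf m)` for all `m ≠ n`: `χ` takes the same value on `g`, `g'` whenever the tree
  path from `(g·P₀).vertex N` to `(g'·P₀).vertex N` meets no branch over `(n, true)` at its centre-type vertices;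
* `edgeMap_edgeOf_ne_of_ne_one` — an element `c` with `Φ(c) ≠ 1`, for a character `Φ` killing `ker ρ_N` and
  the conjugates of the branch image `⟨a·b^{pⁿ}⟩‾`, fixes NO tree edge over the edge `n` at a centre-type vertex
  (abc-iut-L3-t11's branch-stabiliser dictionary).

No definition, no named fact; no side taken on [IUTchIII] Cor 3.12.
-/

noncomputable section

open CategoryTheory Topology Multiplicative

namespace Literature.AnabelianGeometry.SemiGraphs

open IwahoriWitness

namespace ProfiniteSemiGraph

variable {p : ℕ} [hp : Fact p.Prime] {h36 : (metabelianLeafStar p).Prop36Hypotheses}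
  (P₀ : ((metabelianLeafStar p).galoisLevelData h36).PointSeq h36.isCountable (leafStarCentre p))

/-! ### Leaf sequences of translates -/

/-- The two branches of a base edge are distinct. [cite: MochizukiSemiAnbd2006, §1 p.11] -/
theorem leafStar_branch_true_ne_false (m : ℕ) : ((m, true) : ℕ × Bool) ≠ (m, false) := by simp


/-- **The leaf sequences of a translate are the translates of the leaf sequences.**
[cite: MochizukiSemiAnbd2006, Thm 3.7(iii) p.41] -/
theorem leafSeq_smul (a : ((metabelianLeafStar p).galoisLevelData h36).temperedPi h36.isCountable) (m : ℕ) :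
    leafSeq (P₀.smul a) m = (leafSeq P₀ m).smul a := by
  unfold leafSeq
  rw [GaloisLevelData.PointSeq.toEdgeSeq_smul, GaloisLevelData.EdgeSeq.gluePointSeq_smul]

/-- **Un-gluing the leaf sequence along the leaf branch gives back the un-glued centre sequence.**
[cite: MochizukiSemiAnbd2006, Thm 3.7(iii) p.41] -/
theorem toEdgeSeq_leafSeq (m : ℕ) :
    (leafSeq P₀ m).toEdgeSeq ((m, false) : ℕ × Bool) (leafStar_abuts_false' p m) =
      P₀.toEdgeSeq ((m, true) : ℕ × Bool) (leafStar_abuts_true' p m) := by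
  apply GaloisLevelData.EdgeSeq.ext
  intro n
  rw [GaloisLevelData.PointSeq.toEdgeSeq_pt, leafSeq, GaloisLevelData.EdgeSeq.gluePointSeq_pt_of_eq,
    (((metabelianLeafStar p).galoisLevelData h36).cover h36.isCountable n).glue_inv_hom]

/-- Un-gluing a translated leaf sequence along the leaf branch gives the un-glued translated centre sequence.
[cite: MochizukiSemiAnbd2006, Thm 3.7(iii) p.41] -/
theorem toEdgeSeq_leafSeq_smul (a : ((metabelianLeafStar p).galoisLevelData h36).temperedPi h36.isCountable)
    (m : ℕ) :
    ((leafSeq P₀ m).smul a).toEdgeSeq ((m, false) : ℕ × Bool) (leafStar_abuts_false' p m) =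
      (P₀.smul a).toEdgeSeq ((m, true) : ℕ × Bool) (leafStar_abuts_true' p m) := by
  rw [← leafSeq_smul]
  exact toEdgeSeq_leafSeq (P₀.smul a) m

/-- **The glued edge joins the centre vertex to the leaf vertex**: `((a·P₀).toEdgeSeq (m,true)).edge N` joins
`(a·P₀).vertex N` to `(a·P_m).vertex N`. [cite: MochizukiSemiAnbd2006, Thm 3.7(iii) p.41] -/
theorem joins_toEdgeSeq_edge (a : ((metabelianLeafStar p).galoisLevelData h36).temperedPi h36.isCountable)
    (N m : ℕ) :
    (((metabelianLeafStar p).galoisLevelData h36).tree N).Joins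
      (((P₀.smul a).toEdgeSeq ((m, true) : ℕ × Bool) (leafStar_abuts_true' p m)).edge N)
      ((P₀.smul a).vertex N) (((leafSeq P₀ m).smul a).vertex N) := by
  have hj := ((P₀.smul a).toEdgeSeq ((m, true) : ℕ × Bool) (leafStar_abuts_true' p m))
    |>.joins_edge_gluePointSeq_vertex N ((m, true) : ℕ × Bool) ((m, false) : ℕ × Bool)
    (leafStar_branch_true_ne_false m) (leafStarCentre p) (leafStarLeaf p m) (leafStar_abuts_true' p m)
    (leafStar_abuts_false' p m) rfl (leafStar_edgeOf_false_eq_true p m)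
  rw [GaloisLevelData.PointSeq.gluePointSeq_toEdgeSeq] at hj
  rw [← leafSeq_smul]
  exact hj

/-! ### One step of a walk: across an edge at a centre-type vertex, and at a leaf-type vertex -/

/-- **Centre step**: the far end of the tree edge carrying the branch `c` at `(g·P₀).vertex N` over `(m, true)` is
the vertex `((g ψ₀(f))·P_m).vertex N` for some `f ∈ F̂₂⁽ᵖ⁾`. [cite: MochizukiSemiAnbd2006, Rmk 2.2.1 p.24] -/
theorem exists_leafSeq_smul_vertex_eq
    (g : ((metabelianLeafStar p).galoisLevelData h36).temperedPi h36.isCountable) (N m : ℕ)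
    (c c' : (((metabelianLeafStar p).galoisLevelData h36).tree N).Branch)
    (hcb : (((metabelianLeafStar p).galoisLevelData h36).treeProj N).branchMap c = ((m, true) : ℕ × Bool))
    (hc : (((metabelianLeafStar p).galoisLevelData h36).tree N).abuts c = some ((P₀.smul g).vertex N))
    (hcc' : c ≠ c')
    (hee : (((metabelianLeafStar p).galoisLevelData h36).tree N).edgeOf c' =
      (((metabelianLeafStar p).galoisLevelData h36).tree N).edgeOf c)
    {z : (((metabelianLeafStar p).galoisLevelData h36).tree N).Vertex}
    (hc' : (((metabelianLeafStar p).galoisLevelData h36).tree N).abuts c' = some z) :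
    ∃ f : FreeProPRankTwo.Grp p, z = ((leafSeq P₀ m).smul (g * psi0 P₀ f)).vertex N := by
  obtain ⟨gᵥ, hedge⟩ := (P₀.smul g).exists_edgeOf_eq_toEdgeSeq_edge N ((m, true) : ℕ × Bool)
    (leafStar_abuts_true' p m) c hcb hc
  -- the recentred translate is `(g ψ₀(gᵥ⁻¹)) · P₀`
  have hPa : (P₀.smul g).smul ((P₀.smul g).decompHom gᵥ⁻¹) = P₀.smul (g * psi0 P₀ gᵥ⁻¹) := by
    rw [GaloisLevelData.PointSeq.decompHom_smul, GaloisLevelData.PointSeq.smul_smul, inv_mul_cancel_right]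
    rfl
  have hvert : (P₀.smul (g * psi0 P₀ gᵥ⁻¹)).vertex N = (P₀.smul g).vertex N := by
    rw [← hPa]; exact (P₀.smul g).smul_decompHom_vertex gᵥ⁻¹ N
  rw [hPa] at hedge
  have hj := joins_toEdgeSeq_edge P₀ (g * psi0 P₀ gᵥ⁻¹) N m
  rw [hvert] at hj
  have hz := SemiGraph.abuts_eq_of_joins (((metabelianLeafStar p).galoisLevelData h36).isTree_tree N).isTree.isAcyclic
    hj hedge (hee.trans hedge) hcc' hc
  rw [hc'] at hz
  exact ⟨gᵥ⁻¹, Option.some.inj hz⟩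

/-- **Leaf step**: the far end of the tree edge carrying the branch `c` at `(a·P_m).vertex N` (over `(m, false)`)
is the vertex `((a ψ_m(l))·P₀).vertex N` for some `l ∈ Leaf m`. [cite: MochizukiSemiAnbd2006, Rmk 2.2.1 p.24] -/
theorem exists_smul_vertex_eq_of_leafSeq
    (a : ((metabelianLeafStar p).galoisLevelData h36).temperedPi h36.isCountable) (N m : ℕ)
    (c c' : (((metabelianLeafStar p).galoisLevelData h36).tree N).Branch)
    (hcb : (((metabelianLeafStar p).galoisLevelData h36).treeProj N).branchMap c = ((m, false) : ℕ × Bool))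
    (hc : (((metabelianLeafStar p).galoisLevelData h36).tree N).abuts c =
      some (((leafSeq P₀ m).smul a).vertex N))
    (hcc' : c ≠ c')
    (hee : (((metabelianLeafStar p).galoisLevelData h36).tree N).edgeOf c' =
      (((metabelianLeafStar p).galoisLevelData h36).tree N).edgeOf c)
    {z : (((metabelianLeafStar p).galoisLevelData h36).tree N).Vertex}
    (hc' : (((metabelianLeafStar p).galoisLevelData h36).tree N).abuts c' = some z) :
    ∃ l : Iw.Leaf (p := p) m, z = (P₀.smul (a * psiLeaf P₀ m l)).vertex N := by
  obtain ⟨lᵥ, hedge⟩ := ((leafSeq P₀ m).smul a).exists_edgeOf_eq_toEdgeSeq_edge N ((m, false) : ℕ × Bool)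
    (leafStar_abuts_false' p m) c hcb hc
  have hLa : ((leafSeq P₀ m).smul a).smul (((leafSeq P₀ m).smul a).decompHom lᵥ⁻¹) =
      (leafSeq P₀ m).smul (a * psiLeaf P₀ m lᵥ⁻¹) := by
    rw [GaloisLevelData.PointSeq.decompHom_smul, GaloisLevelData.PointSeq.smul_smul, inv_mul_cancel_right]
    rfl
  have hvert : ((leafSeq P₀ m).smul (a * psiLeaf P₀ m lᵥ⁻¹)).vertex N = ((leafSeq P₀ m).smul a).vertex N := by
    rw [← hLa]; exact ((leafSeq P₀ m).smul a).smul_decompHom_vertex lᵥ⁻¹ N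
  rw [hLa] at hedge
  -- un-glue the translated leaf sequence: it is the un-glued translated centre sequence
  have hedge' : (((metabelianLeafStar p).galoisLevelData h36).tree N).edgeOf c =
      ((P₀.smul (a * psiLeaf P₀ m lᵥ⁻¹)).toEdgeSeq ((m, true) : ℕ × Bool) (leafStar_abuts_true' p m)).edge N :=
    hedge.trans (congrArg (fun X => GaloisLevelData.EdgeSeq.edge X N) (toEdgeSeq_leafSeq_smul P₀ _ m))
  have hj := joins_toEdgeSeq_edge P₀ (a * psiLeaf P₀ m lᵥ⁻¹) N m
  rw [hvert] at hj
  obtain ⟨b₁, b₂, hne, hb₁e, hb₂e, hb₁, hb₂⟩ := hj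
  have hz := SemiGraph.abuts_eq_of_joins (((metabelianLeafStar p).galoisLevelData h36).isTree_tree N).isTree.isAcyclic
    ⟨b₂, b₁, hne.symm, hb₂e, hb₁e, hb₂, hb₁⟩ hedge' (hee.trans hedge') hcc' hc
  rw [hc'] at hz
  exact ⟨lᵥ⁻¹, Option.some.inj hz⟩

/-! ### Characters constant on transporters -/

section Chi

variable {A : Type*} [CommGroup A]
  (χ : ((metabelianLeafStar p).galoisLevelData h36).temperedPi h36.isCountable →* A) (N : ℕ)
  (hker : ∀ g, ((metabelianLeafStar p).galoisLevelData h36).proj h36.isCountable N g = 1 → χ g = 1)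
  (h0 : ∀ f : FreeProPRankTwo.Grp p, χ (psi0 P₀ f) = 1)

include hker h0 in
/-- **A character killing `ker ρ_N` and `ψ₀(Π_centre)` takes the same value on any two elements translating
`P₀` to the same level-`N` vertex.** [cite: MochizukiSemiAnbd2006, Thm 3.7(iii) p.41] -/
theorem chi_eq_of_smul_vertex_eq (g g' : ((metabelianLeafStar p).galoisLevelData h36).temperedPi h36.isCountable)
    (h : (P₀.smul g).vertex N = (P₀.smul g').vertex N) : χ g = χ g' := by
  obtain ⟨k, hk⟩ := P₀.exists_proj_eq_one_of_smul_vertex_eq N g g' h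
  have h1 := hker _ hk
  have h2 : χ (P₀.decompHom k) = 1 := h0 k
  rw [map_mul χ, map_mul χ, map_inv χ, map_inv χ, map_mul χ, map_mul χ, map_inv χ, h2, mul_one, mul_inv_cancel,
    inv_one, mul_one, mul_inv_eq_one] at h1
  exact h1.symm

include hker h0 in
/-- **THE WALK LEMMA.**  Let `χ` kill `ker ρ_N`, `ψ₀(Π_centre)` and `ψ_m(Leaf m)` for every `m ≠ n`.  If a path of
the subdivision of `𝔾̃_N` from `(g·P₀).vertex N` to `(g'·P₀).vertex N` carries, at its centre-type vertices
`(a·P₀).vertex N`, no branch over `(n, true)`, then `χ g = χ g'`: walking centre → leaf `m` → centre multiplies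
the transporter by `ψ₀(f) ψ_m(l)`, invisible to `χ`. [cite: MochizukiSemiAnbd2006, Thm 3.7(iii) p.41] -/
theorem chi_eq_of_walk (n : ℕ) (hleaf : ∀ m, m ≠ n → ∀ l : Iw.Leaf (p := p) m, χ (psiLeaf P₀ m l) = 1)
    (g g' : ((metabelianLeafStar p).galoisLevelData h36).temperedPi h36.isCountable)
    (q : (((metabelianLeafStar p).galoisLevelData h36).tree N).subdivision.Walk
      (Sum.inl ((P₀.smul g).vertex N)) (Sum.inl ((P₀.smul g').vertex N))) (hq : q.IsPath)
    (havoid : ∀ (a : ((metabelianLeafStar p).galoisLevelData h36).temperedPi h36.isCountable)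
      (β : (((metabelianLeafStar p).galoisLevelData h36).tree N).Branch),
      (((metabelianLeafStar p).galoisLevelData h36).tree N).abuts β = some ((P₀.smul a).vertex N) →
      (Sum.inr (Sum.inr β) : (((metabelianLeafStar p).galoisLevelData h36).tree N).Node) ∈ q.support →
      (((metabelianLeafStar p).galoisLevelData h36).treeProj N).branchMap β ≠ ((n, true) : ℕ × Bool)) :
    χ g = χ g' := by
  -- the type of a branch at a centre-type / leaf-type vertex
  have htype_centre : ∀ (a : ((metabelianLeafStar p).galoisLevelData h36).temperedPi h36.isCountable) (β : (((metabelianLeafStar p).galoisLevelData h36).tree N).Branch),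
      (((metabelianLeafStar p).galoisLevelData h36).tree N).abuts β = some ((P₀.smul a).vertex N) →
        (((metabelianLeafStar p).galoisLevelData h36).treeProj N).branchMap β = (((((metabelianLeafStar p).galoisLevelData h36).treeProj N).branchMap β).1, true) := by
    intro a β hβ
    have h1 := (((metabelianLeafStar p).galoisLevelData h36).treeProj N).abuts_branchMap β _ hβ
    rw [(P₀.smul a).treeProj_vertexMap_vertex N] at h1
    exact SemiGraph.leafStar_abuts_eq_some_none_iff.1 h1
  have htype_leaf : ∀ (m : ℕ) (a : ((metabelianLeafStar p).galoisLevelData h36).temperedPi h36.isCountable) (β : (((metabelianLeafStar p).galoisLevelData h36).tree N).Branch),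
      (((metabelianLeafStar p).galoisLevelData h36).tree N).abuts β = some (((leafSeq P₀ m).smul a).vertex N) → (((metabelianLeafStar p).galoisLevelData h36).treeProj N).branchMap β = (m, false) := by
    intro m a β hβ
    have h1 := (((metabelianLeafStar p).galoisLevelData h36).treeProj N).abuts_branchMap β _ hβ
    rw [((leafSeq P₀ m).smul a).treeProj_vertexMap_vertex N] at h1
    exact SemiGraph.leafStar_abuts_eq_some_some_iff.1 h1
  -- induction along the path, two edges at a time
  have main : ∀ k : ℕ, 8 * k ≤ q.length →
      ∃ gk : ((metabelianLeafStar p).galoisLevelData h36).temperedPi h36.isCountable, q.getVert (8 * k) = Sum.inl ((P₀.smul gk).vertex N) ∧ χ gk = χ g := by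
    intro k
    induction k with
    | zero => exact fun _ => ⟨g, by rw [Nat.mul_zero, q.getVert_zero], rfl⟩
    | succ k ih =>
      intro hk
      obtain ⟨gk, hgk, hχk⟩ := ih (by omega)
      -- first edge: centre → leaf `m`
      obtain ⟨-, c, c', e₁, z₁, hcc', hce, hc'e, hcz, hc'z, h1, -, -, h4⟩ :=
        SemiGraph.path_inl_segment q hq (i := 8 * k) (by omega) hgk
      have hcb : (((metabelianLeafStar p).galoisLevelData h36).treeProj N).branchMap c = (((((metabelianLeafStar p).galoisLevelData h36).treeProj N).branchMap c).1, true) := htype_centre gk c hcz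
      have hmn : ((((metabelianLeafStar p).galoisLevelData h36).treeProj N).branchMap c).1 ≠ n := by
        intro hmn
        exact havoid gk c hcz (by rw [← h1]; exact q.getVert_mem_support _) (by rw [hcb, hmn])
      obtain ⟨f, hz₁⟩ := exists_leafSeq_smul_vertex_eq P₀ gk N _ c c' hcb hcz hcc' (hc'e.trans hce.symm) hc'z
      -- second edge: leaf `m` → centre
      rw [hz₁] at h4
      obtain ⟨-, c₂, c₂', e₂, z₂, hcc₂, hc₂e, hc₂'e, hc₂z, hc₂'z, -, -, -, h8⟩ :=
        SemiGraph.path_inl_segment q hq (i := 8 * k + 4) (by omega) h4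
      have hc₂b := htype_leaf _ _ c₂ hc₂z
      obtain ⟨l, hz₂⟩ := exists_smul_vertex_eq_of_leafSeq P₀ _ N _ c₂ c₂' hc₂b hc₂z hcc₂
        (hc₂'e.trans hc₂e.symm) hc₂'z
      refine ⟨gk * psi0 P₀ f * psiLeaf P₀ _ l, ?_, ?_⟩
      · rw [show 8 * (k + 1) = 8 * k + 4 + 4 by ring, h8, hz₂]
      · rw [map_mul, map_mul, h0, hleaf _ hmn, mul_one, mul_one, hχk]
  -- the length is a multiple of `8`: vertex positions are the multiples of `4`, of alternating type
  have h4 : 4 * (q.length / 4) = q.length := by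
    by_contra hne
    have hlt : 4 * (q.length / 4) < q.length := lt_of_le_of_ne (Nat.mul_div_le _ _) hne
    obtain ⟨z, hz⟩ := SemiGraph.exists_getVert_four_mul_eq_inl q hq (q.length / 4) (Nat.mul_div_le _ _)
    have h := (SemiGraph.path_inl_segment q hq hlt hz).1
    omega
  have h8 : 8 * (q.length / 8) = q.length := by
    rcases Nat.even_or_odd (q.length / 4) with ⟨i, hi⟩ | ⟨i, hi⟩
    · omega
    · -- odd: the last vertex would be of leaf type
      exfalso
      have hlen : q.length = 8 * i + 4 := by omega
      obtain ⟨gi, hgi, -⟩ := main i (by omega)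
      obtain ⟨-, c, c', e₁, z₁, hcc', hce, hc'e, hcz, hc'z, -, -, -, h4'⟩ :=
        SemiGraph.path_inl_segment q hq (i := 8 * i) (by omega) hgi
      have hcb := htype_centre gi c hcz
      obtain ⟨f, hz₁⟩ := exists_leafSeq_smul_vertex_eq P₀ gi N _ c c' hcb hcz hcc' (hc'e.trans hce.symm) hc'z
      rw [← hlen, q.getVert_length] at h4'
      have hzz : (P₀.smul g').vertex N = z₁ := by simpa using h4'
      have hproj := congrArg (((metabelianLeafStar p).galoisLevelData h36).treeProj N).vertexMap hzz
      rw [(P₀.smul g').treeProj_vertexMap_vertex N, hz₁,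
        ((leafSeq P₀ _).smul _).treeProj_vertexMap_vertex N] at hproj
      exact Option.some_ne_none _ hproj.symm
  obtain ⟨gK, hgK, hχK⟩ := main (q.length / 8) (by omega)
  rw [h8, q.getVert_length] at hgK
  have hvert : (P₀.smul g').vertex N = (P₀.smul gK).vertex N := by simpa using hgK
  rw [← hχK]
  exact (chi_eq_of_smul_vertex_eq P₀ χ N hker h0 g' gK hvert).symm

end Chi

/-! ### An element seen by `Φ^{(n)}` fixes no edge over `n` at a centre-type vertex -/

/-- **No fixed edge over `n`.**  Let `Φ` be a character of `π₁^temp` killing `ker ρ_N` and every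
`ψ₀(f·θα n(k)·f⁻¹)`.  An element `c` with `Φ(c) ≠ 1` fixes, at level `N`, no tree edge carrying a branch over
`(n, true)` at a centre-type vertex `(a·P₀).vertex N`: by abc-iut-L3-t11's branch-stabiliser dictionary the
level-`N` component of such a `c` would be that of `a ψ₀(f θα_n(k) f⁻¹) a⁻¹`, killed by `Φ`.
[cite: MochizukiSemiAnbd2006, Rmk 2.2.1 p.24] -/
theorem edgeMap_edgeOf_ne_of_ne_one {A : Type*} [CommGroup A]
    (Φ : ((metabelianLeafStar p).galoisLevelData h36).temperedPi h36.isCountable →* A) (N n : ℕ)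
    (hker : ∀ g, ((metabelianLeafStar p).galoisLevelData h36).proj h36.isCountable N g = 1 → Φ g = 1)
    (hbr : ∀ (f : FreeProPRankTwo.Grp p) (k : Multiplicative ℤ_[p]),
      Φ (psi0 P₀ (f * FreeProPRankTwo.θα p n k * f⁻¹)) = 1)
    (c : ((metabelianLeafStar p).galoisLevelData h36).temperedPi h36.isCountable) (hc : Φ c ≠ 1)
    (a : ((metabelianLeafStar p).galoisLevelData h36).temperedPi h36.isCountable)
    (β : (((metabelianLeafStar p).galoisLevelData h36).tree N).Branch)
    (hβb : (((metabelianLeafStar p).galoisLevelData h36).treeProj N).branchMap β = ((n, true) : ℕ × Bool))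
    (hβ : (((metabelianLeafStar p).galoisLevelData h36).tree N).abuts β = some ((P₀.smul a).vertex N)) :
    (((metabelianLeafStar p).galoisLevelData h36).treeAct h36.isCountable N c).hom.edgeMap
        ((((metabelianLeafStar p).galoisLevelData h36).tree N).edgeOf β) ≠
      (((metabelianLeafStar p).galoisLevelData h36).tree N).edgeOf β := by
  intro hfix
  obtain ⟨f, k, h⟩ := (P₀.smul a).exists_proj_eq_proj_decompHom_conj_brHom N c ((n, true) : ℕ × Bool)
    (leafStar_abuts_true' p n) β hβb hβ hfix
  rw [GaloisLevelData.PointSeq.decompHom_smul] at h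
  have h1 : ((metabelianLeafStar p).galoisLevelData h36).proj h36.isCountable N
      (c * (a * P₀.decompHom (f * (metabelianLeafStar p).brHom (n, true) (leafStarCentre p)
        (leafStar_abuts_true' p n) k * f⁻¹) * a⁻¹)⁻¹) = 1 := by
    rw [map_mul, map_inv, h, mul_inv_cancel]
  have h2 := hker _ h1
  have h3 : Φ (P₀.decompHom (f * (metabelianLeafStar p).brHom (n, true) (leafStarCentre p)
      (leafStar_abuts_true' p n) k * f⁻¹)) = 1 := hbr f k
  rw [map_mul Φ, map_inv Φ, mul_inv_eq_one, map_mul Φ, map_mul Φ, map_inv Φ, h3, mul_one, mul_inv_cancel] at h2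
  exact hc h2

end ProfiniteSemiGraph

end Literature.AnabelianGeometry.SemiGraphs

end
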